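/-
Copyright (c) 2026 the pub-hodgecm-mathlib formalisation cell (harness21).  Prover seat hodgecm-mathlib-LH4-p11 (g5), req620 Track A «(D-RAM) FOUR-FRAME» squad
(unit U2H_HSide, the (ρ2b′-X) road :418; bottom socket (A) «type U» of payer LH4-p14 (g4∕g5)'s TypeSplit; statement = `SOCKET-hOCA.v1` 0e05dba0 verbatim).
-/
import Summits.HodgeConjecture.HodgeConjecture.Theorems.F0P3cDyRamFixedPointCensusTypeTwoCensusOfOrderCountsV3   -- ★ (this seat): brings every token of the bottom sockets
import Summits.HodgeConjecture.HodgeConjecture.Theorems.F0P3cDyRamTypeUBottomFacts                 -- ★ p857997 (this seat): brick 1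
import Summits.HodgeConjecture.HodgeConjecture.Theorems.F0P3cDyRamTypeTwoBlockCongruenceNhds         -- ★ p858116 (this seat): brick 6, the `V`
import Summits.HodgeConjecture.HodgeConjecture.Theorems.F0P3cDyRamUniformizerPowerTube              -- ★ p858117 (this seat): brick 7, the depth letters
import Summits.HodgeConjecture.HodgeConjecture.Theorems.F0P3cDyRamTypeTwoTubeLetters                 -- ★ p858060 (this seat): brick 5, tube letters
import Summits.HodgeConjecture.HodgeConjecture.Theorems.F0P3cDyRamUnramifiedQuadraticCompletionDictionary   -- ★ LH4-p10: the e = 1 dictionary (type U isometry)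
import Literature.NumberTheory.Automorphic.AdicCompletionCompact                                -- ★ `finite_residueField_adicCompletion`
import Summits.HodgeConjecture.HodgeConjecture.Theorems.F0P3cDyRamHSideClosedForm                   -- ★ LH4-p09: the (H) organ `hSide_closedForm_of_tube_exists`
import Literature.NumberTheory.Automorphic.RamifiedPlaceResidueApproximation                       -- ★ p857812 (LH4-p09): `exists_valued_sub_toPlace_lt_one_of_ne_one`
import Literature.NumberTheory.Automorphic.ProjectiveDescentLatticeLevelsDischarge                 -- ★ `valued_toPlace_eq_pow_two_of_ramified`
import Summits.HodgeConjecture.HodgeConjecture.Theorems.F0P3cDyRamTypeASelector                      -- ★ p858170 (this seat): brick 8, the type-(A) branch kill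
import Summits.HodgeConjecture.HodgeConjecture.Theorems.F0P3cDyRamTypeTwoLevelDictionary               -- ★ p858041 (this seat): brick 3
import Summits.HodgeConjecture.HodgeConjecture.Theorems.F0P3cDyRamTypeTwoDepthDictionary               -- ★ p858045 (this seat): brick 4
import Summits.HodgeConjecture.HodgeConjecture.Theorems.F0P3cDyRamOrderFiltrationRange                 -- ★ (α) `isOrd_pow_iff_le`
import Literature.NumberTheory.Rogawski1990.FinExplicitTransferFactorInertExponent                  -- ★ `eval_finCharpolyTwo_finGammaTwo_apply_eq_quadratic`
import Summits.HodgeConjecture.HodgeConjecture.Theorems.F0P3cDyRamConeWeightHalfSplit                 -- ★ p857610/p857697 (this seat): flip unit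
import Summits.HodgeConjecture.HodgeConjecture.Theorems.F0P3cDyRamConeTubeBound                       -- ★ LH4-p05: GAP-R `le_of_levelSetDep_nonempty`
import Summits.HodgeConjecture.HodgeConjecture.Theorems.F0P3cDyRamToricCensusSumUnrReindex            -- ★ LH4-p08: reindex `orderCounts_eq_censusSum_unr_of_cells`
import Summits.HodgeConjecture.HodgeConjecture.Theorems.F0P3cDyRamFixedPointCensusTypeTwoPrelude      -- ★ p857439: `setOf_typeZero_fixed_eq_setOf_isSelfDualLattice_block`, `valued_toPlace_uniformizer_pow`
import Literature.NumberTheory.Automorphic.UnitaryGroupFormTransport                                -- ★ `conj_mem_unitaryGroupOfForm_iff`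
import Literature.NumberTheory.Rogawski1990.UnitaryVertexStabilizerCoverCM                          -- ★ `isUnit_det_placeForm`, `placeForm_map_transpose_of_hermitian`, `isPrincipalIdealRing_integer_adicCompletion`
import Literature.NumberTheory.Automorphic.LocalUnitaryGroupCongr                                   -- ★ `antidiagOne_isHermitian`, `isUnit_antidiagOne_det`
import Summits.HodgeConjecture.HodgeConjecture.Theorems.F0P3cDyRamTypeTwoAnisotropyOfFrame            -- ★ p858030 (this seat): brick 2 `haniso`
import Summits.HodgeConjecture.HodgeConjecture.Theorems.F0P3cDyRamToricLevelCensusUnrAtThirdField     -- ★ the G-side weld `toricCensusSum_unr_weld_of_frame`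
import Summits.HodgeConjecture.HodgeConjecture.Theorems.F0P3cDyRamTokenRealizabilityUnrOfFrame       -- ★ p858115 (LH4-p14): `hreal_of_frame_typeU`
import Summits.HodgeConjecture.HodgeConjecture.Theorems.F0P3cDyRamSideNormCriterionRamK               -- ★ p858055: `two_le_of_datum_of_v_two_lt_one`
import Summits.HodgeConjecture.HodgeConjecture.Theorems.F0P3cDyRamCensusBottomArith                   -- ★ LH4-p07: `census_bottom_arith_inert`
import Summits.HodgeConjecture.HodgeConjecture.Theorems.F0P3cDyRamOrderCountCensusUnrSign              -- ★ p858347 (this seat): step 15, the sign `(β, θ)_v = (−1)^(m+d)`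
import HarnessLib

/-!
# Crux `H413`, line LH4 «(D-RAM) FOUR-FRAME» — the (ρ2b′-X) road, BOTTOM SOCKET (A), TYPE U: THE ORDER-COUNT CENSUS `orderCountCensusA`

Cell `hodgecm-mathlib` (D-0151), FLOOR 0, crux item H413 = `stmt-HodgeConjecture-24833`, route of record `HCCMUnconditional`; squad F0∕P3c∕LH4; registered stub served:
`F0P3cDyRamFourFrameU2H.stub_U2H_fixedPointCensus_typeTwo_unit0` ((ρ2b′-X), U2H ED. 15 :418) through payer LH4-p14's ★ TypeSplit (`orderCountCensus2_of_types`, slot (A)) and this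
seat's ★ `F0P3cDyRamFixedPointCensusTypeTwoCensusOfOrderCountsV3` ∘ `…CensusOfOrderFormsV3`.  STATEMENT = payer's socket text `SOCKET-hOCA.v1` (sha16 0e05dba0) VERBATIM: for `γ_H`
near `1 ∈ H_v = U(Φ₂) × U(Φ₁)(L⁺_v)` of TYPE (2) at a wild ramified CM place `w ∣ v` (datum `IsRamifiedQuadraticDatum σ_w ϖ d t_E`, `|2|_w < 1`), in the eigen-package letters of a third
field of TYPE U (`|α − ρα| = 1`, `|ρα − Θα| < 1`): the `hFN` clause and, for every depth token `m` and `β`-token, the ORDER-COUNT CENSUS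
`(q − 1)·(OC_h − OC_h′) = (β, θ)_v · q^m · ((q − 1)(#Fix_{γ₂} + d%2) − 2(q^(d − d%2) − 1))`.
PROOF = composition of ★ organs, no new mathematics in this file: the neighbourhood `V` (★ `exists_nhds_one_block_congr` at depth `ϖ^(2d+5t_E+2)`); the `hFN` clause (★
`forall_fixed_fixed_isNorm_of_typeU`); tube letters (★ `F0P3cDyRamTypeTwoTubeLetters`); the H-side organ (★ LH4-p09 `hSide_closedForm_of_tube_exists`) whose EISENSTEIN disjunct is
refuted on type (A) (★ `not_eisensteinDatum_typeA`), leaving the INERT law `(q−1)(#Fix + d%2) + 2 = (q+1)qⁿ` and the level `jλ = 2n`; the `Φ₁`-coordinate and depth letters (★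
`F0P3cDyRamTypeUBottomFacts`, `…DepthDictionary`, `…LevelDictionary`, LH4-p14's ★ m-token reading is re-derived inline); the order filtration range (★ `isOrd_pow_iff_le`); the flip unit
(★ `exists_flipUnit_of_forall_fixed_fixed_isNorm`) and GAP-R (★ LH4-p05 `le_of_levelSetDep_nonempty`) in both frames; the re-indexing (★ LH4-p08 `orderCounts_eq_censusSum_unr_of_cells`);
the G-side weld (★ `toricCensusSum_unr_weld_of_frame`, with ★ LH4-p14 `hreal_of_frame_typeU`); the sign `(β, θ)_v = (−1)^(m+d)` (★ LH4-p13 O-Sign `hilbertSymbol_token_eq_neg_one_pow`,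
its `hA` read from the model ★ `hilbertSymbol_eq_one_iff_even_of_unramifiedModel` on the line `j(F) ⊕ j(F)·𝔩`, `𝔩 = λ′ − ρλ′` (★ `F0P3cDyRamTypeASignModel`), with hKev ★ LH4-p14
`even_v_of_thetaRho_fixed` and hKnorm ★ LH4-p14 `exists_thetaRho_fixed_unit_norm_eq`); and the bottom arithmetic (★ LH4-p07 `census_bottom_arith_inert`).
ONE THEOREM (no `def`, no instance, no notation, no `sorry`); lane `--supports stmt-HodgeConjecture-24833 --as helper` (count-neutral).
HONEST LABEL.  Count-neutral; nothing printed is asserted; (ρ2b′-X) stays OPEN until the payer's head lands; `HC_CM` is proved only modulo the 7 printed citations (2 remaining named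
inputs: hLiu418 = `stmt-HodgeConjecture-24832`, h413 = `stmt-HodgeConjecture-24833`) until rung 0 closes.

References: [Rogawski1990] J. D. Rogawski, *Automorphic Representations of Unitary Groups in Three Variables* (1990), §4.9 Prop. 4.9.1 (b) p. 55, Lemma 4.9.3 p. 56;
[Kottwitz1986BaseChangeUnits] R. Kottwitz, Compositio Math. 60 (1986), §1 pp. 240–241; [LabesseLanglands1979] J.-P. Labesse, R. P. Langlands, Canad. J. Math. 31 (1979), §2 pp. 8–10.
-/

set_option autoImplicit false

noncomputable section
namespace Summit.HodgeConjecture.HodgeConjecture.Cruxes.H413.F0P3cDyRamOrderCountCensusUnr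

open MeasureTheory Measure NumberField IsDedekindDomain Topology Filter
open Literature.NumberTheory.Automorphic Literature.NumberTheory.Automorphic.UnitaryGroup Literature.NumberTheory.Automorphic.IntegralReduction
open Literature.NumberTheory.Rogawski1990 Literature.NumberTheory.GaloisRepresentations
open Literature.NumberTheory.Automorphic.UnitaryThreeFourFrame
open scoped Matrix MatrixGroups Classical Valued
open Literature.NumberTheory.Automorphic.UnitaryLatticeTree Literature.NumberTheory.Automorphic.HermitianLattice
open Literature.NumberTheory.QuadraticForms
open Summit.HodgeConjecture.HodgeConjecture.Cruxes.H413.F0P3cDyRamToricCensusDefs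

set_option maxHeartbeats 800000 in
/-- **BOTTOM (A), TYPE U — THE ORDER-COUNT CENSUS** (statement = payer LH4-p14's `SOCKET-hOCA.v1` 0e05dba0 verbatim): near `1 ∈ H_v`, for type-(2) `γ_H` at a wild ramified CM
place and a type-U third field, the `hFN` clause and `(q − 1)·(OC_h − OC_h′) = (β, θ)_v · q^m · ((q − 1)(#Fix_{γ₂} + d%2) − 2(q^(d − d%2) − 1))` — composition of the ★ organs listed in
the module docstring. [cite: Rogawski1990, §4.9 Prop. 4.9.1 (b) p. 55, Lemma 4.9.3 p. 56] [cite: Kottwitz1986BaseChangeUnits, §1 pp. 240–241] [cite: LabesseLanglands1979, §2 pp. 8–10] -/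
theorem orderCountCensusA (L : Type) [Field L] [NumberField L] [IsCMField L]
    {v : HeightOneSpectrum (𝓞 ↥(maximalRealSubfield L))} (w : UnitaryGroup.PlacesOver L v)
    (hw : IsCMField.complexConj L • w.1 = w.1) (he : v.asIdeal.ramificationIdx' w.1.asIdeal ≠ 1)
    (ϖ : (w.1.adicCompletion L)) (hϖ : Valued.v ϖ = WithZero.exp (-1 : ℤ)) (d tE : ℕ)
    (hD : IsRamifiedQuadraticDatum (galAdicCompletionMap (L := L) (IsCMField.complexConj L) hw) ϖ d tE) (h2v : Valued.v (2 : (w.1.adicCompletion L)) < 1)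
    [Fintype (Valued.ResidueField (w.1.adicCompletion L))] :
    ∃ V ∈ 𝓝 (1 : ((UnitaryGroup.cmDatum L 2 (Matrix.of fun i j : Fin 2 => if i.val + j.val + 1 = 2 then (1 : L) else 0)).Local v × (UnitaryGroup.cmDatum L 1 (Matrix.of fun i j : Fin 1 => if i.val + j.val + 1 = 1 then (1 : L) else 0)).Local v)), ∀ γH ∈ V, IsLocalGRegular L v γH →
      ¬ (∃ x : (w.1.adicCompletion L), (((((γH).1.val : GL (Fin 2) (UnitaryGroup.LocalRing L v)).val.map (Pi.evalRingHom (fun w' : UnitaryGroup.PlacesOver L v => w'.1.adicCompletion L) w))).charpoly).IsRoot x) →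
      ∀ (E' : Type) [Field E'] [NumberField E'] [Algebra L E'] [Algebra.IsQuadraticExtension L E'] (c₁ : E' ≃ₐ[L] E') (δ : E') (m₀ : L)
        (s : (w.1.adicCompletion L)) (w₁ : UnitaryGroup.PlacesOver E' w.1) (hw₁ : c₁ • w₁.1 = w₁.1)
        (Θ : (w₁.1.adicCompletion E') →+* (w₁.1.adicCompletion E')) (α lam : (w₁.1.adicCompletion E')),
        c₁ ≠ 1 → c₁ δ = -δ → δ ≠ 0 → algebraMap L E' m₀ = δ ^ 2 → s ≠ 0 →
        (((γH.1.val : GL (Fin 2) (UnitaryGroup.LocalRing L v)).val.map (Pi.evalRingHom (fun w' : UnitaryGroup.PlacesOver L v => w'.1.adicCompletion L) w))).trace * (((γH.1.val : GL (Fin 2) (UnitaryGroup.LocalRing L v)).val.map (Pi.evalRingHom (fun w' : UnitaryGroup.PlacesOver L v => w'.1.adicCompletion L) w))).trace - 4 * (((γH.1.val : GL (Fin 2) (UnitaryGroup.LocalRing L v)).val.map (Pi.evalRingHom (fun w' : UnitaryGroup.PlacesOver L v => w'.1.adicCompletion L) w))).det = s * s * ((m₀ : L) : (w.1.adicCompletion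 L)) →
        (((γH.1.val : GL (Fin 2) (UnitaryGroup.LocalRing L v)).val.map (Pi.evalRingHom (fun w' : UnitaryGroup.PlacesOver L v => w'.1.adicCompletion L) w))).det * (galAdicCompletionMap (L := L) (IsCMField.complexConj L) hw) (((γH.1.val : GL (Fin 2) (UnitaryGroup.LocalRing L v)).val.map (Pi.evalRingHom (fun w' : UnitaryGroup.PlacesOver L v => w'.1.adicCompletion L) w))).det = 1 → (((γH.1.val : GL (Fin 2) (UnitaryGroup.LocalRing L v)).val.map (Pi.evalRingHom (fun w' : UnitaryGroup.PlacesOver L v => w'.1.adicCompletion L) w))).trace = (((γH.1.val : GL (Fin 2) (UnitaryGroup.LocalRing L v)).val.map (Pi.evalRingHom (fun w' : UnitaryGroup.PlacesOver L v => w'.1.adicCompletion L) w))).det * (galAdicCompletionMap (L := L) (IsCMField.complexConj L) hw) (((γH.1.val : GL (Fin 2) (UnitaryGroup.LocalRing L v)).val.map (Pi.evalRingHom (fun w' : UnitaryGroup.PlacesOver L v => w'.1.adicCompletion L) w))).trace →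
        (∀ x : (w.1.adicCompletion L), x * x - (((γH.1.val : GL (Fin 2) (UnitaryGroup.LocalRing L v)).val.map (Pi.evalRingHom (fun w' : UnitaryGroup.PlacesOver L v => w'.1.adicCompletion L) w))).trace * x + (((γH.1.val : GL (Fin 2) (UnitaryGroup.LocalRing L v)).val.map (Pi.evalRingHom (fun w' : UnitaryGroup.PlacesOver L v => w'.1.adicCompletion L) w))).det ≠ 0) →
        (∀ z, galAdicCompletionMap (L := E') c₁ hw₁ (galAdicCompletionMap (L := E') c₁ hw₁ z) = z) →
        (∀ z, Valued.v (galAdicCompletionMap (L := E') c₁ hw₁ z) = Valued.v z) →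
        (∀ a, galAdicCompletionMap (L := E') c₁ hw₁ (toPlace w.1 w₁ a) = toPlace w.1 w₁ a) →
        (∀ a, Valued.v (toPlace w.1 w₁ a) ≤ 1 ↔ Valued.v a ≤ 1) →
        (∀ z : (w₁.1.adicCompletion E'), galAdicCompletionMap (L := E') c₁ hw₁ z = z ↔ ∃ a, toPlace w.1 w₁ a = z) →
        (∀ a, Θ (toPlace w.1 w₁ a) = toPlace w.1 w₁ ((galAdicCompletionMap (L := L) (IsCMField.complexConj L) hw) a)) →
        (∀ z, Θ (Θ z) = z) →
        (∀ z, Θ (galAdicCompletionMap (L := E') c₁ hw₁ z) = galAdicCompletionMap (L := E') c₁ hw₁ (Θ z)) →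
        (∀ z, Valued.v (Θ z) = Valued.v z) →
        galAdicCompletionMap (L := E') c₁ hw₁ α ≠ α →
        Valued.v α ≤ 1 →
        (∀ z : (w₁.1.adicCompletion E'), Valued.v z ≤ 1 → Valued.v ((z - galAdicCompletionMap (L := E') c₁ hw₁ z) / (α - galAdicCompletionMap (L := E') c₁ hw₁ α)) ≤ 1) →
        2 * lam = toPlace w.1 w₁ (((γH.1.val : GL (Fin 2) (UnitaryGroup.LocalRing L v)).val.map (Pi.evalRingHom (fun w' : UnitaryGroup.PlacesOver L v => w'.1.adicCompletion L) w))).trace + toPlace w.1 w₁ s * ((δ : E') : (w₁.1.adicCompletion E')) →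
        lam * lam = toPlace w.1 w₁ (((γH.1.val : GL (Fin 2) (UnitaryGroup.LocalRing L v)).val.map (Pi.evalRingHom (fun w' : UnitaryGroup.PlacesOver L v => w'.1.adicCompletion L) w))).trace * lam - toPlace w.1 w₁ (((γH.1.val : GL (Fin 2) (UnitaryGroup.LocalRing L v)).val.map (Pi.evalRingHom (fun w' : UnitaryGroup.PlacesOver L v => w'.1.adicCompletion L) w))).det →
        galAdicCompletionMap (L := E') c₁ hw₁ lam = toPlace w.1 w₁ (((γH.1.val : GL (Fin 2) (UnitaryGroup.LocalRing L v)).val.map (Pi.evalRingHom (fun w' : UnitaryGroup.PlacesOver L v => w'.1.adicCompletion L) w))).trace - lam →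
        Θ lam * lam = 1 →
        Valued.v lam = 1 →
        (∀ z : (w₁.1.adicCompletion E'), ∃! pq : (w.1.adicCompletion L) × (w.1.adicCompletion L), z = toPlace w.1 w₁ pq.1 + toPlace w.1 w₁ pq.2 * lam) →
        Valued.v (α - (galAdicCompletionMap (L := E') c₁ hw₁) α) = 1 →
        Valued.v ((galAdicCompletionMap (L := E') c₁ hw₁) α - Θ α) < 1 →
        ∀ (th ta : ((UnitaryGroup.cmDatum L 3 (Matrix.of fun i j : Fin 3 => if i.val + j.val + 1 = 3 then (1 : L) else 0)).Local v)) (P₁ : GL (Fin 3) (w.1.adicCompletion L)) (dg : Fin 2 → (w.1.adicCompletion L)) (η : (w.1.adicCompletion L)) (γ₁ : GL (Fin 2) (w.1.adicCompletion L)),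
          ((localNonsplitEquiv (IsCMField.complexConj L) (Matrix.of fun i j : Fin 3 => if i.val + j.val + 1 = 3 then (1 : L) else 0) (IsCMField.complexConj_ne_one L) w hw th : ↥(unitaryGroupOfForm (galAdicCompletionMap (L := L) (IsCMField.complexConj L) hw) (placeForm (Matrix.of fun i j : Fin 3 => if i.val + j.val + 1 = 3 then (1 : L) else 0) w.1))) : GL (Fin 3) (w.1.adicCompletion L)) = endoGL (((localNonsplitEquiv (IsCMField.complexConj L) (Matrix.of fun i j : Fin 2 => if i.val + j.val + 1 = 2 then (1 : L) else 0) (IsCMField.complexConj_ne_one L) w hw γH.1 : ↥(unitaryGroupOfForm (galAdicCompletionMap (L := L) (IsCMField.complexConj L) hw) (placeForm (Matrix.of fun i j : Fin 2 => if i.val + j.val + 1 = 2 then (1 : L) else 0) w.1))) : GL (Fin 2) (w.1.adicCompletion L)), ((localNonsplitEquiv (IsCMField.complexConj L) (Matrix.of fun i j : Fin 1 => if i.val + j.val + 1 = 1 then (1 : L) else 0) (IsCMField.complexConj_ne_one L) w hw γH.2).val : GL (Fin 1) (w.1.adicCompletion L))) →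
          ((localNonsplitEquiv (IsCMField.complexConj L) (Matrix.of fun i j : Fin 3 => if i.val + j.val + 1 = 3 then (1 : L) else 0) (IsCMField.complexConj_ne_one L) w hw ta : ↥(unitaryGroupOfForm (galAdicCompletionMap (L := L) (IsCMField.complexConj L) hw) (placeForm (Matrix.of fun i j : Fin 3 => if i.val + j.val + 1 = 3 then (1 : L) else 0) w.1))) : GL (Fin 3) (w.1.adicCompletion L)) = P₁ * endoGL (γ₁, ((localNonsplitEquiv (IsCMField.complexConj L) (Matrix.of fun i j : Fin 1 => if i.val + j.val + 1 = 1 then (1 : L) else 0) (IsCMField.complexConj_ne_one L) w hw γH.2).val : GL (Fin 1) (w.1.adicCompletion L))) * P₁⁻¹ →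
          formCongr (galAdicCompletionMap (L := L) (IsCMField.complexConj L) hw) P₁ (placeForm (Matrix.of fun i j : Fin 3 => if i.val + j.val + 1 = 3 then (1 : L) else 0) w.1) = (!![(Matrix.diagonal dg) 0 0, 0, (Matrix.diagonal dg) 0 1; 0, η, 0; (Matrix.diagonal dg) 1 0, 0, (Matrix.diagonal dg) 1 1] : Matrix (Fin 3) (Fin 3) (w.1.adicCompletion L)) →
          (∀ i, Valued.v (dg i) = 1) →
          (∀ i, (galAdicCompletionMap (L := L) (IsCMField.complexConj L) hw) (dg i) = dg i) →
          (galAdicCompletionMap (L := L) (IsCMField.complexConj L) hw) η = η →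
          Valued.v η = 1 →
          (¬ ∃ t : (w.1.adicCompletion L), t * (galAdicCompletionMap (L := L) (IsCMField.complexConj L) hw) t = η) →
          γ₁ ∈ unitaryGroupOfForm (galAdicCompletionMap (L := L) (IsCMField.complexConj L) hw) (Matrix.diagonal dg) →
          (γ₁ : Matrix (Fin 2) (Fin 2) (w.1.adicCompletion L)).charpoly = (((γH.1.val : GL (Fin 2) (UnitaryGroup.LocalRing L v)).val.map (Pi.evalRingHom (fun w' : UnitaryGroup.PlacesOver L v => w'.1.adicCompletion L) w))).charpoly →
        ∀ (φ : (Fin 2 → (w.1.adicCompletion L)) →+ (w₁.1.adicCompletion E')) (h : (w₁.1.adicCompletion E')) (φ' : (Fin 2 → (w.1.adicCompletion L)) →+ (w₁.1.adicCompletion E')) (h' : (w₁.1.adicCompletion E')),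
          (∀ (c : (w.1.adicCompletion L)) (x : Fin 2 → (w.1.adicCompletion L)), φ (c • x) = toPlace w.1 w₁ c * φ x) →
          Function.Injective φ →
          Function.Surjective φ →
          (∀ x, φ ((((localNonsplitEquiv (IsCMField.complexConj L) (Matrix.of fun i j : Fin 2 => if i.val + j.val + 1 = 2 then (1 : L) else 0) (IsCMField.complexConj_ne_one L) w hw γH.1 : ↥(unitaryGroupOfForm (galAdicCompletionMap (L := L) (IsCMField.complexConj L) hw) (placeForm (Matrix.of fun i j : Fin 2 => if i.val + j.val + 1 = 2 then (1 : L) else 0) w.1))) : GL (Fin 2) (w.1.adicCompletion L)) : Matrix (Fin 2) (Fin 2) (w.1.adicCompletion L)).mulVec x) = lam * φ x) →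
          (∀ x y, toPlace w.1 w₁ (pairing (galAdicCompletionMap (L := L) (IsCMField.complexConj L) hw) (placeForm (Matrix.of fun i j : Fin 2 => if i.val + j.val + 1 = 2 then (1 : L) else 0) w.1) x y) = h * Θ (φ x) * φ y + galAdicCompletionMap (L := E') c₁ hw₁ (h * Θ (φ x) * φ y)) →
          Θ h = h →
          h ≠ 0 →
          (∃ x : (w₁.1.adicCompletion E'), x ≠ 0 ∧ h * Θ x * x + galAdicCompletionMap (L := E') c₁ hw₁ (h * Θ x * x) = 0) →
          (∀ (c : (w.1.adicCompletion L)) (x : Fin 2 → (w.1.adicCompletion L)), φ' (c • x) = toPlace w.1 w₁ c * φ' x) →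
          Function.Injective φ' →
          Function.Surjective φ' →
          (∀ x, φ' ((γ₁ : Matrix (Fin 2) (Fin 2) (w.1.adicCompletion L)).mulVec x) = lam * φ' x) →
          (∀ x y, toPlace w.1 w₁ (pairing (galAdicCompletionMap (L := L) (IsCMField.complexConj L) hw) (Matrix.diagonal dg) x y) = h' * Θ (φ' x) * φ' y + galAdicCompletionMap (L := E') c₁ hw₁ (h' * Θ (φ' x) * φ' y)) →
          Θ h' = h' →
          h' ≠ 0 →
          (∀ (t : (w.1.adicCompletion L)) (n : ℤ), Valued.v (toPlace w.1 w₁ t) = Valued.v (toPlace w.1 w₁ ϖ) ^ n ↔ Valued.v t = Valued.v ϖ ^ n) →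
          (∀ c : (w₁.1.adicCompletion E'), galAdicCompletionMap (L := E') c₁ hw₁ c = c → c ≠ 0 → Valued.v c ≤ 1 → ∃ n : ℕ, Valued.v c = Valued.v (toPlace w.1 w₁ ϖ) ^ n) →
          (∀ t : (w₁.1.adicCompletion E'), galAdicCompletionMap (L := E') c₁ hw₁ t = t → Valued.v t < 1 → Valued.v t ≤ Valued.v (toPlace w.1 w₁ ϖ)) →
            ∀ (J R R' : ℕ) (f f' : ℕ → ℕ → AddSubgroup (w₁.1.adicCompletion E') → ℕ),
            {M₃ : Submodule (Valued.integer (w.1.adicCompletion L)) (Fin 3 → (w.1.adicCompletion L)) | IsVertexLattice (galAdicCompletionMap (L := L) (IsCMField.complexConj L) hw) ϖ ((StdForm.antidiagonal 3).over (w.1.adicCompletion L)) 0 M₃ ∧ mapGL (endoGL (((localNonsplitEquiv (IsCMField.complexConj L) (Matrix.of fun i j : Fin 2 => if i.val + j.val + 1 = 2 then (1 : L) else 0) (IsCMField.complexConj_ne_one L) w hw γH.1 : ↥(unitaryGroupOfForm (galAdicCompletionMap (L := L) (IsCMField.complexConj L) hw) (placeForm (Matrix.of fun i j : Fin 2 =>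 if i.val + j.val + 1 = 2 then (1 : L) else 0) w.1))) : GL (Fin 2) (w.1.adicCompletion L)), ((localNonsplitEquiv (IsCMField.complexConj L) (Matrix.of fun i j : Fin 1 => if i.val + j.val + 1 = 1 then (1 : L) else 0) (IsCMField.complexConj_ne_one L) w hw γH.2).val : GL (Fin 1) (w.1.adicCompletion L)))) M₃ = M₃}.Finite →
            (∀ M₃ : Submodule (Valued.integer (w.1.adicCompletion L)) (Fin 3 → (w.1.adicCompletion L)), IsVertexLattice (galAdicCompletionMap (L := L) (IsCMField.complexConj L) hw) ϖ ((StdForm.antidiagonal 3).over (w.1.adicCompletion L)) 0 M₃ → mapGL (endoGL (((localNonsplitEquiv (IsCMField.complexConj L) (Matrix.of fun i j : Fin 2 => if i.val + j.val + 1 = 2 then (1 : L) else 0) (IsCMField.complexConj_ne_one L) w hw γH.1 : ↥(unitaryGroupOfForm (galAdicCompletionMap (L := L) (IsCMField.complexConj L) hw) (placeForm (Matrix.of fun i j : Fin 2 => if i.val + j.val + 1 = 2 then (1 : L) else 0) w.1))) : GL (Fin 2) (w.1.adicCompletion L)), ((localNonsplitEquiv (IsCMField.complexConj L) (Matrix.of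 fun i j : Fin 1 => if i.val + j.val + 1 = 1 then (1 : L) else 0) (IsCMField.complexConj_ne_one L) w hw γH.2).val : GL (Fin 1) (w.1.adicCompletion L)))) M₃ = M₃ →
              ∀ b : ℕ, (∀ c : (w.1.adicCompletion L), (Pi.single 1 c : Fin 3 → (w.1.adicCompletion L)) ∈ M₃ ↔ Valued.v c ≤ Valued.v ϖ ^ b) → b ≤ R) →
            {M₃ : Submodule (Valued.integer (w.1.adicCompletion L)) (Fin 3 → (w.1.adicCompletion L)) | IsSelfDualLattice (galAdicCompletionMap (L := L) (IsCMField.complexConj L) hw) ϖ (!![(Matrix.diagonal dg) 0 0, 0, (Matrix.diagonal dg) 0 1; 0, η, 0; (Matrix.diagonal dg) 1 0, 0, (Matrix.diagonal dg) 1 1] : Matrix (Fin 3) (Fin 3) (w.1.adicCompletion L)) M₃ ∧ mapGL (endoGL (γ₁, ((localNonsplitEquiv (IsCMField.complexConj L) (Matrix.of fun i j : Fin 1 => if i.val + j.val + 1 = 1 then (1 : L) else 0) (IsCMField.complexConj_ne_one L) w hw γH.2).val : GL (Fin 1) (w.1.adicCompletion L)))) M₃ = M₃}.Finite →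
            (∀ M₃ : Submodule (Valued.integer (w.1.adicCompletion L)) (Fin 3 → (w.1.adicCompletion L)), IsSelfDualLattice (galAdicCompletionMap (L := L) (IsCMField.complexConj L) hw) ϖ (!![(Matrix.diagonal dg) 0 0, 0, (Matrix.diagonal dg) 0 1; 0, η, 0; (Matrix.diagonal dg) 1 0, 0, (Matrix.diagonal dg) 1 1] : Matrix (Fin 3) (Fin 3) (w.1.adicCompletion L)) M₃ → mapGL (endoGL (γ₁, ((localNonsplitEquiv (IsCMField.complexConj L) (Matrix.of fun i j : Fin 1 => if i.val + j.val + 1 = 1 then (1 : L) else 0) (IsCMField.complexConj_ne_one L) w hw γH.2).val : GL (Fin 1) (w.1.adicCompletion L)))) M₃ = M₃ →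
              ∀ b : ℕ, (∀ c : (w.1.adicCompletion L), (Pi.single 1 c : Fin 3 → (w.1.adicCompletion L)) ∈ M₃ ↔ Valued.v c ≤ Valued.v ϖ ^ b) → b ≤ R') →
            ¬ IsOrd (galAdicCompletionMap (L := E') c₁ hw₁) α (toPlace w.1 w₁ ϖ ^ (J + 1)) lam →
            (∀ j a, (levelSet (galAdicCompletionMap (L := E') c₁ hw₁) Θ α (toPlace w.1 w₁ ϖ) h j a).Finite) →
            (∀ j a, (levelSet (galAdicCompletionMap (L := E') c₁ hw₁) Θ α (toPlace w.1 w₁ ϖ) h' j a).Finite) →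
            Valued.v ((((localNonsplitEquiv (IsCMField.complexConj L) (Matrix.of fun i j : Fin 1 => if i.val + j.val + 1 = 1 then (1 : L) else 0) (IsCMField.complexConj_ne_one L) w hw γH.2).val : GL (Fin 1) (w.1.adicCompletion L)) : Matrix (Fin 1) (Fin 1) (w.1.adicCompletion L)) 0 0) = 1 →
            (∀ (b j : ℕ) (Λ : AddSubgroup (w₁.1.adicCompletion E')) (x₀ : (w₁.1.adicCompletion E')) (r : (w.1.adicCompletion L)), 1 ≤ b → x₀ ≠ 0 →
              (∀ x, x ∈ Λ ↔ ∃ z, IsOrd (galAdicCompletionMap (L := E') c₁ hw₁) α (toPlace w.1 w₁ ϖ ^ j) z ∧ x = x₀ * z) →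
              IsOrd (galAdicCompletionMap (L := E') c₁ hw₁) α (toPlace w.1 w₁ ϖ ^ j) (dualGen (galAdicCompletionMap (L := E') c₁ hw₁) Θ α (toPlace w.1 w₁ ϖ ^ j) h x₀) → ¬ IsOrd (galAdicCompletionMap (L := E') c₁ hw₁) α (toPlace w.1 w₁ ϖ ^ j) (dualGen (galAdicCompletionMap (L := E') c₁ hw₁) Θ α (toPlace w.1 w₁ ϖ ^ j) h x₀ / toPlace w.1 w₁ ϖ) →
              Valued.v (dualGen (galAdicCompletionMap (L := E') c₁ hw₁) Θ α (toPlace w.1 w₁ ϖ ^ j) h x₀) = Valued.v (toPlace w.1 w₁ ϖ) ^ b →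
              (∀ b', (∀ x ∈ Λ, Valued.v (h * Θ x * b' + galAdicCompletionMap (L := E') c₁ hw₁ (h * Θ x * b')) ≤ 1) → (lam - toPlace w.1 w₁ ((((localNonsplitEquiv (IsCMField.complexConj L) (Matrix.of fun i j : Fin 1 => if i.val + j.val + 1 = 1 then (1 : L) else 0) (IsCMField.complexConj_ne_one L) w hw γH.2).val : GL (Fin 1) (w.1.adicCompletion L)) : Matrix (Fin 1) (Fin 1) (w.1.adicCompletion L)) 0 0)) * b' ∈ Λ) →
              IsOrd (galAdicCompletionMap (L := E') c₁ hw₁) α (toPlace w.1 w₁ ϖ ^ j) lam → toPlace w.1 w₁ r = glueUnit (galAdicCompletionMap (L := E') c₁ hw₁) Θ α (toPlace w.1 w₁ ϖ ^ j) h (toPlace w.1 w₁ ϖ) (toPlace w.1 w₁ 1) x₀ b →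
              f b j Λ = Nat.card {x : 𝒪[(w.1.adicCompletion L)] ⧸ 𝓂[(w.1.adicCompletion L)] ^ (2 * b) // ∃ u' : 𝒪[(w.1.adicCompletion L)], Ideal.Quotient.mk (𝓂[(w.1.adicCompletion L)] ^ (2 * b)) u' = x ∧
                Valued.v ((u' : (w.1.adicCompletion L)) * (galAdicCompletionMap (L := L) (IsCMField.complexConj L) hw) u' - r) ≤ Valued.v (ϖ ^ (2 * b))}) →
            (∀ (b j : ℕ) (Λ : AddSubgroup (w₁.1.adicCompletion E')) (x₀ : (w₁.1.adicCompletion E')) (r : (w.1.adicCompletion L)), 1 ≤ b → x₀ ≠ 0 →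
              (∀ x, x ∈ Λ ↔ ∃ z, IsOrd (galAdicCompletionMap (L := E') c₁ hw₁) α (toPlace w.1 w₁ ϖ ^ j) z ∧ x = x₀ * z) →
              IsOrd (galAdicCompletionMap (L := E') c₁ hw₁) α (toPlace w.1 w₁ ϖ ^ j) (dualGen (galAdicCompletionMap (L := E') c₁ hw₁) Θ α (toPlace w.1 w₁ ϖ ^ j) h' x₀) → ¬ IsOrd (galAdicCompletionMap (L := E') c₁ hw₁) α (toPlace w.1 w₁ ϖ ^ j) (dualGen (galAdicCompletionMap (L := E') c₁ hw₁) Θ α (toPlace w.1 w₁ ϖ ^ j) h' x₀ / toPlace w.1 w₁ ϖ) →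
              Valued.v (dualGen (galAdicCompletionMap (L := E') c₁ hw₁) Θ α (toPlace w.1 w₁ ϖ ^ j) h' x₀) = Valued.v (toPlace w.1 w₁ ϖ) ^ b →
              (∀ b', (∀ x ∈ Λ, Valued.v (h' * Θ x * b' + galAdicCompletionMap (L := E') c₁ hw₁ (h' * Θ x * b')) ≤ 1) → (lam - toPlace w.1 w₁ ((((localNonsplitEquiv (IsCMField.complexConj L) (Matrix.of fun i j : Fin 1 => if i.val + j.val + 1 = 1 then (1 : L) else 0) (IsCMField.complexConj_ne_one L) w hw γH.2).val : GL (Fin 1) (w.1.adicCompletion L)) : Matrix (Fin 1) (Fin 1) (w.1.adicCompletion L)) 0 0)) * b' ∈ Λ) →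
              IsOrd (galAdicCompletionMap (L := E') c₁ hw₁) α (toPlace w.1 w₁ ϖ ^ j) lam → toPlace w.1 w₁ r = glueUnit (galAdicCompletionMap (L := E') c₁ hw₁) Θ α (toPlace w.1 w₁ ϖ ^ j) h' (toPlace w.1 w₁ ϖ) (toPlace w.1 w₁ η) x₀ b →
              f' b j Λ = Nat.card {x : 𝒪[(w.1.adicCompletion L)] ⧸ 𝓂[(w.1.adicCompletion L)] ^ (2 * b) // ∃ u' : 𝒪[(w.1.adicCompletion L)], Ideal.Quotient.mk (𝓂[(w.1.adicCompletion L)] ^ (2 * b)) u' = x ∧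
                Valued.v ((u' : (w.1.adicCompletion L)) * (galAdicCompletionMap (L := L) (IsCMField.complexConj L) hw) u' - r) ≤ Valued.v (ϖ ^ (2 * b))}) →
          (∀ f₀ : (w₁.1.adicCompletion E'), galAdicCompletionMap (L := E') c₁ hw₁ f₀ = f₀ → Θ f₀ = f₀ → Valued.v f₀ = 1 → ∃ z : (w₁.1.adicCompletion E'), z * Θ z = f₀) ∧
          (∀ (m : ℕ) (β : (v.adicCompletion ↥(maximalRealSubfield L))ˣ), Valued.v (((finCharpolyTwo L v γH).eval (finGammaTwo L v γH)) w) = Valued.v ((toPlace v w (HeckeCharacter.uniformizer ↥(maximalRealSubfield L) v : v.adicCompletion ↥(maximalRealSubfield L))) ^ m) →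
            toPlace v w (β : (v.adicCompletion ↥(maximalRealSubfield L))) = -(((finCharpolyTwo L v γH).eval (finGammaTwo L v γH)) w * (finGammaTwo L v γH w ^ 2 + ((γH.1.val.val : Matrix (Fin 2) (Fin 2) (UnitaryGroup.LocalRing L v)).map (Pi.evalRingHom (fun w' : UnitaryGroup.PlacesOver L v => w'.1.adicCompletion L) w)).det)) / (2 * finGammaTwo L v γH w ^ 2 * ((γH.1.val.val : Matrix (Fin 2) (Fin 2) (UnitaryGroup.LocalRing L v)).map (Pi.evalRingHom (fun w' : UnitaryGroup.PlacesOver L v => w'.1.adicCompletion L) w)).det) →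
            (((Fintype.card (Valued.ResidueField (w.1.adicCompletion L))) : ℤ) - 1) * ((((∑ j ∈ Finset.range (J + 1), (if IsOrd (galAdicCompletionMap (L := E') c₁ hw₁) α (toPlace w.1 w₁ ϖ ^ j) lam then (levelSet (galAdicCompletionMap (L := E') c₁ hw₁) Θ α (toPlace w.1 w₁ ϖ) h j 0).ncard else 0)) + ∑ b ∈ Finset.Icc 1 R, ∑ j ∈ Finset.range (J + 1), (if IsOrd (galAdicCompletionMap (L := E') c₁ hw₁) α (toPlace w.1 w₁ ϖ ^ j) lam then Nat.card 𝓀[(w.1.adicCompletion L)] ^ b * (levelSetDep (galAdicCompletionMap (L := E') c₁ hw₁) Θ α (toPlace w.1 w₁ ϖ) h j b (lam - toPlace w.1 w₁ ((((localNonsplitEquiv (IsCMField.complexConj L) (Matrix.of fun i j : Fin 1 => if i.val + j.val + 1 = 1 then (1 : L) else 0) (IsCMField.complexConj_ne_one L) w hw γH.2).val : GL (Fin 1) (w.1.adicCompletion L)) : Matrix (Fin 1) (Fin 1) (w.1.adicCompletion L)) 0 0))).ncard else 0) : ℕ) : ℤ) - (((∑ j ∈ Finset.range (J + 1), (if IsOrd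 (galAdicCompletionMap (L := E') c₁ hw₁) α (toPlace w.1 w₁ ϖ ^ j) lam then (levelSet (galAdicCompletionMap (L := E') c₁ hw₁) Θ α (toPlace w.1 w₁ ϖ) h' j 0).ncard else 0)) + ∑ b ∈ Finset.Icc 1 R', ∑ j ∈ Finset.range (J + 1), (if IsOrd (galAdicCompletionMap (L := E') c₁ hw₁) α (toPlace w.1 w₁ ϖ ^ j) lam then Nat.card 𝓀[(w.1.adicCompletion L)] ^ b * (levelSetDep (galAdicCompletionMap (L := E') c₁ hw₁) Θ α (toPlace w.1 w₁ ϖ) h' j b (lam - toPlace w.1 w₁ ((((localNonsplitEquiv (IsCMField.complexConj L) (Matrix.of fun i j : Fin 1 => if i.val + j.val + 1 = 1 then (1 : L) else 0) (IsCMField.complexConj_ne_one L) w hw γH.2).val : GL (Fin 1) (w.1.adicCompletion L)) : Matrix (Fin 1) (Fin 1) (w.1.adicCompletion L)) 0 0))).ncard else 0) : ℕ) : ℤ)) = (Literature.NumberTheory.QuadraticForms.hilbertSymbol (v.adicCompletion ↥(maximalRealSubfield L)) (β : (v.adicCompletion ↥(maximalRealSubfield L))) (algebraMap ↥(maximalRealSubfield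 L) _ ((cmQuadraticGenerator L : 𝓞 ↥(maximalRealSubfield L)) : ↥(maximalRealSubfield L))) : ℤ) * ((Fintype.card (Valued.ResidueField (w.1.adicCompletion L))) : ℤ) ^ m * ((((Fintype.card (Valued.ResidueField (w.1.adicCompletion L))) : ℤ) - 1) * (((Nat.card (MulAction.fixedBy (((UnitaryGroup.cmDatum L 2 (Matrix.of fun i j : Fin 2 => if i.val + j.val + 1 = 2 then (1 : L) else 0)).Local v) ⧸ cmLocalIntegralLevel L 2 (Matrix.of fun i j : Fin 2 => if i.val + j.val + 1 = 2 then (1 : L) else 0) v) γH.1)) + d % 2 : ℕ) : ℤ) - 2 * (((Fintype.card (Valued.ResidueField (w.1.adicCompletion L))) : ℤ) ^ (d - d % 2) - 1))) := by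
  classical
  -- THE DEPTH OF RECORD `c := ϖ^N`, `N := n + tE`, `n := 2d + 4tE + 2` (all organs' side conditions by `omega`), and THE NEIGHBOURHOOD `V` (★ brick 6)
  obtain ⟨V, hV, hVc⟩ := F0P3cDyRamTypeTwoBlockCongruenceNhds.exists_nhds_one_block_congr L v w
    (c := ϖ ^ (2 * d + 4 * tE + 2 + tE)) (F0P3cDyRamUniformizerPowerTube.pow_ne_zero_of_v hϖ _)
  refine ⟨V, hV, ?_⟩
  intro γH hγV hreg htyp E' _i₁ _i₂ _i₃ _i₄ c₁ δ m₀ s w₁ hw₁ Θ α lam hc₁ hδ hδ0 hm₀ hs0 hdisc hDD htr hχ hρρ hvρ hρj hjv hjfix hΘj hΘΘ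
    hΘρ hvΘ hα hα1 hint h2lam hlam2 hρlam hΘlam hlam huniq hA hτα th ta P₁ dg η γ₁ hth hta hfc hdg1 hdgσ hησ hη1 hηN hγ₁U hchar
    φ h φ' h' hφs hφi hφo hφγ hform hΘh hh hiso hφ's hφ'i hφ'o hφ'γ hform' hΘh' hh' hjpow hEval hϖmax
    J R R' f f' hfinF hR hfinF' hR' hJ hfinLS hfinLS' hu hf hf'
  obtain ⟨hg, hu₂⟩ := hVc γH hγV
  -- instances on `M = E′_{w₁}`
  haveI : Finite 𝓀[w₁.1.adicCompletion E'] := finite_residueField_adicCompletion E' w₁.1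
  -- the type-U isometry `|jE a| = |a|` (★ p10) and the `M`-uniformiser `jE ϖ`
  have hjv1 : ∀ a, Valued.v (toPlace w.1 w₁ a) = Valued.v a := fun a =>
    F0P3cDyRamUnramifiedQuadraticCompletionDictionary.valued_toPlace_of_v_sub_galAdicCompletionMap_eq_one E' c₁ w.1 hc₁ w₁ hw₁ hα1 hA a
  have hϖE : Valued.v (toPlace w.1 w₁ ϖ) = WithZero.exp (-1 : ℤ) := by rw [hjv1, hϖ]
  refine ⟨?_, ?_⟩
  · -- THE `hFN` CONJUNCT (★ brick 1)
    exact F0P3cDyRamTypeUBottomFacts.forall_fixed_fixed_isNorm_of_typeU hvρ hΘΘ hvΘ hα1 hA hτα hϖE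
  · intro m β hm hβ
    -- LETTERS OF THE PLACE DATUM and of the depth `N`
    obtain ⟨hσσ, hσv, -, hfixw, hdd, hd1, h2t⟩ := id hD
    have hN : 2 * d + tE ≤ 2 * (2 * d + 4 * tE + 2) + 1 ∧ 2 * tE < 2 * d + 4 * tE + 2 ∧ tE < 2 * d + 4 * tE + 2 + tE ∧ 2 * tE < 2 * d + 4 * tE + 2 + tE ∧
        2 * tE + 2 ≤ 2 * d + 4 * tE + 2 + tE ∧ tE ≤ 2 * d + 4 * tE + 2 + tE ∧ 2 * d + 4 * tE + 2 + tE - tE = 2 * d + 4 * tE + 2 ∧ 2 * d ≤ 2 * d + 4 * tE + 2 + tE := by omega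
    have hc2 : Valued.v (ϖ ^ (2 * d + 4 * tE + 2 + tE)) < Valued.v (2 : w.1.adicCompletion L) :=
      F0P3cDyRamUniformizerPowerTube.v_pow_lt_v_two hϖ h2t hN.2.2.1
    have hcϖ := F0P3cDyRamUniformizerPowerTube.v_pow_sq_lt_tube hϖ h2t hN.2.2.2.2.1
    -- TUBE LETTERS of the block (★ brick 5)
    have htr2 := F0P3cDyRamTypeTwoTubeLetters.v_trace_eq_v_two hc2 hg
    have htube := F0P3cDyRamTypeTwoTubeLetters.v_disc_lt_tube hc2 hcϖ hg
    have h20 : (2 : w.1.adicCompletion L) ≠ 0 := fun h0 => by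
      have := h2t; rw [h0, map_zero] at this
      exact (pow_ne_zero tE (by rw [hϖ]; exact WithZero.exp_ne_zero)) this.symm
    have ht0 : (((γH.1.val : GL (Fin 2) (UnitaryGroup.LocalRing L v)).val.map
        (Pi.evalRingHom (fun w' : UnitaryGroup.PlacesOver L v => w'.1.adicCompletion L) w))).trace ≠ 0 := fun h0 => by
      rw [h0, map_zero] at htr2; exact h20 ((map_eq_zero _).1 htr2.symm)
    -- THE H-SIDE ORGAN (★ LH4-p09 `hSide_closedForm_of_tube_exists`), uniformiser `ϖF` of `F_v`
    have hϖF := HeckeCharacter.valued_uniformizer (K := ↥(maximalRealSubfield L)) v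
    obtain ⟨αH, sH, g, uτ, wτ, z, n, dK, hαH, hvαH, hsH, hsg, hz, hdat, huO, hbranch, hdK, hlev⟩ :=
      F0P3cDyRamHSideClosedForm.hSide_closedForm_of_tube_exists L v w hw hϖF he
        hD γH.1 htyp htube
    -- THE TYPE-(A) BRANCH KILL (★ brick 8 `not_eisensteinDatum_typeA`): the EISENSTEIN disjunct is impossible
    have hσι : ∀ y, (galAdicCompletionMap (L := L) (IsCMField.complexConj L) hw) (toPlace v w y) = toPlace v w y :=
      fun y => galAdicCompletionMap_toPlace (IsCMField.complexConj L) w w hw y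
    have hι2 : ∀ y, Valued.v (toPlace v w y) = Valued.v y ^ 2 :=
      fun y => valued_toPlace_eq_pow_two_of_ramified (IsCMField.complexConj L) w (IsCMField.complexConj_ne_one L) hw he y
    have hresE : ∀ x : w.1.adicCompletion L, Valued.v x ≤ 1 →
        ∃ y : v.adicCompletion ↥(maximalRealSubfield L), Valued.v (toPlace v w y) ≤ 1 ∧ Valued.v (x - toPlace v w y) < 1 := fun x hx => by
      obtain ⟨y, hy1, hy⟩ := exists_valued_sub_toPlace_lt_one_of_ne_one L (IsCMField.complexConj L) v w (IsCMField.complexConj_ne_one L) hw he x hx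
      exact ⟨y, by rw [hι2]; exact pow_le_one₀ zero_le hy1, hy⟩
    have hσϖ : (galAdicCompletionMap (L := L) (IsCMField.complexConj L) hw) ϖ ≠ ϖ := fun h0 => by
      have h1 := hdd
      rw [h0, sub_self, map_zero] at h1
      exact pow_ne_zero d (by rw [hϖ]; exact WithZero.exp_ne_zero) h1.symm
    have h2M : Valued.v (2 : w₁.1.adicCompletion E') < 1 := by rw [← map_ofNat (toPlace w.1 w₁) 2, hjv1]; exact h2v
    have h2Mne : (2 : w₁.1.adicCompletion E') ≠ 0 := by rw [← map_ofNat (toPlace w.1 w₁) 2]; exact (map_ne_zero _).2 h20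
    have hαH0 : αH ≠ 0 := fun h0 => by
      rw [h0, map_zero] at hvαH
      rcases hvαH with h1 | h1
      · exact zero_ne_one h1
      · exact WithZero.zero_ne_coe h1
    obtain ⟨hwO, hanis, hdK0, hFix⟩ := hbranch.resolve_right fun hE =>
      F0P3cDyRamTypeASelector.not_eisensteinDatum_typeA (toPlace v w) hι2 _ hσι hresE hσϖ (toPlace w.1 w₁) hjv1 _ Θ hρρ hvρ hjfix hΘj hΘΘ
        hΘρ hvΘ hα1 hA hτα h2M h2Mne hlam2 hρlam hΘlam hDD ht0 rfl rfl hαH0 hsH hsg (Matrix.GeneralLinearGroup.det_ne_zero g) hϖF hz hdat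
        hE.1 hE.2.1
    subst hdK0
    -- THE `Φ₁`-COORDINATE `u = jE u₀₀` (★ brick 1) AND THE DEPTH LETTER `m` (★ brick 4)
    have hH1 : IsUnit ((placeForm (Matrix.of fun i j : Fin 1 => if i.val + j.val + 1 = 1 then (1 : L) else 0) w.1) 0 0) := by
      rw [placeForm_antidiagOne]; simp [StdForm.over, StdForm.antidiagonal_J_apply, Fin.rev]
    have hσu := F0P3cDyRamTypeUBottomFacts.mul_map_eq_one_of_mem_unitary_one (galAdicCompletionMap (L := L) (IsCMField.complexConj L) hw) hH1
      (localNonsplitEquiv (IsCMField.complexConj L) (Matrix.of fun i j : Fin 1 => if i.val + j.val + 1 = 1 then (1 : L) else 0)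
        (IsCMField.complexConj_ne_one L) w hw γH.2).2
    obtain ⟨hρu, hu1⟩ := F0P3cDyRamTypeUBottomFacts.map_fixed_and_mul_map_eq_one (ρ := galAdicCompletionMap (L := E') c₁ hw₁) (Θ := Θ)
      (galAdicCompletionMap (L := L) (IsCMField.complexConj L) hw) (toPlace w.1 w₁) hΘj hjfix hσu
    have htok := hm
    rw [eval_finCharpolyTwo_finGammaTwo_apply_eq_quadratic, F0P3cDyRamFixedPointCensusTypeTwoPrelude.valued_toPlace_uniformizer_pow L w hw he m] at htok
    have hmE := F0P3cDyRamTypeTwoDepthDictionary.v_sub_eq_exp_neg_of_token (ρ := galAdicCompletionMap (L := E') c₁ hw₁) (toPlace w.1 w₁) hjv1 hvρ hjfix hρlam hlam2 _ htok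
    -- THE CONDUCTOR LEVEL `jl := 2n` (★ brick 3 letters; `dK = 0`)
    have hsq := F0P3cDyRamTypeTwoLevelDictionary.sq_sub_map_eq_map_disc (ρ := galAdicCompletionMap (L := E') c₁ hw₁) (toPlace w.1 w₁) hρlam hlam2
    have hv2sq : Valued.v (4 : w.1.adicCompletion L) = Valued.v (2 : w.1.adicCompletion L) ^ 2 := by
      rw [show (4 : w.1.adicCompletion L) = 2 * 2 by norm_num, map_mul, sq]
    have hdiscv : Valued.v ((((γH.1.val : GL (Fin 2) (UnitaryGroup.LocalRing L v)).val.map (Pi.evalRingHom (fun w' : UnitaryGroup.PlacesOver L v => w'.1.adicCompletion L) w))).trace ^ 2 -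
        4 * (((γH.1.val : GL (Fin 2) (UnitaryGroup.LocalRing L v)).val.map (Pi.evalRingHom (fun w' : UnitaryGroup.PlacesOver L v => w'.1.adicCompletion L) w))).det) =
        Valued.v ϖ ^ (2 * (2 * n)) := by
      have h : Valued.v ϖ ^ (2 * (2 * n + 0)) *
          Valued.v (((γH.1.val : GL (Fin 2) (UnitaryGroup.LocalRing L v)).val.map (Pi.evalRingHom (fun w' : UnitaryGroup.PlacesOver L v => w'.1.adicCompletion L) w))).trace ^ 2 =
          Valued.v (4 * ((((γH.1.val : GL (Fin 2) (UnitaryGroup.LocalRing L v)).val.map (Pi.evalRingHom (fun w' : UnitaryGroup.PlacesOver L v => w'.1.adicCompletion L) w))).trace ^ 2 -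
            4 * (((γH.1.val : GL (Fin 2) (UnitaryGroup.LocalRing L v)).val.map (Pi.evalRingHom (fun w' : UnitaryGroup.PlacesOver L v => w'.1.adicCompletion L) w))).det)) := hlev
      rw [add_zero, map_mul, htr2, hv2sq, mul_comm] at h
      have h4 : Valued.v (2 : w.1.adicCompletion L) ^ 2 ≠ 0 := pow_ne_zero _ ((Valuation.ne_zero_iff _).2 h20)
      exact (mul_right_injective₀ h4 h).symm
    have hjlv : Valued.v (lam - galAdicCompletionMap (L := E') c₁ hw₁ lam) = WithZero.exp (-((2 * n : ℕ) : ℤ)) := by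
      refine F0P3cDyRamTypeTwoDepthDictionary.eq_exp_neg_of_mul_self_eq ?_
      rw [← map_mul, ← sq, hsq, hjv1, hdiscv, ← map_pow, F0P3cDyRamUniformizerPowerTube.v_pow_eq_exp_neg hϖ]
      congr 1
    have hjl : Valued.v ((lam - toPlace w.1 w₁ ((((localNonsplitEquiv (IsCMField.complexConj L) (Matrix.of fun i j : Fin 1 => if i.val + j.val + 1 = 1 then (1 : L) else 0)
        (IsCMField.complexConj_ne_one L) w hw γH.2).val : GL (Fin 1) (w.1.adicCompletion L)) : Matrix (Fin 1) (Fin 1) (w.1.adicCompletion L)) 0 0)) -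
        galAdicCompletionMap (L := E') c₁ hw₁ (lam - toPlace w.1 w₁ ((((localNonsplitEquiv (IsCMField.complexConj L) (Matrix.of fun i j : Fin 1 => if i.val + j.val + 1 = 1 then (1 : L) else 0)
        (IsCMField.complexConj_ne_one L) w hw γH.2).val : GL (Fin 1) (w.1.adicCompletion L)) : Matrix (Fin 1) (Fin 1) (w.1.adicCompletion L)) 0 0))) =
        WithZero.exp (-((2 * n : ℕ) : ℤ)) := by
      rw [map_sub (galAdicCompletionMap (L := E') c₁ hw₁), hρu, sub_sub_sub_cancel_right]; exact hjlv
    -- THE ORDER FILTRATION RANGE `𝒪_j ∋ lam ⟺ j ≤ 2n` (★ (α)) and `2n ≤ J`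
    have hϖE0 : toPlace w.1 w₁ ϖ ≠ 0 := fun h0 => by rw [h0, map_zero] at hϖE; exact WithZero.zero_ne_coe hϖE
    have hϖE1 : Valued.v (toPlace w.1 w₁ ϖ) < 1 := by rw [hϖE, ← WithZero.exp_zero, WithZero.exp_lt_exp]; norm_num
    have hiff : ∀ j, IsOrd (galAdicCompletionMap (L := E') c₁ hw₁) α (toPlace w.1 w₁ ϖ ^ j) lam ↔ j ≤ 2 * n := fun j =>
      F0P3cDyRamOrderFiltrationRange.isOrd_pow_iff_le hα hϖE0 hϖE1 hlam.le (by rw [hA, mul_one, hjlv, ← map_pow, F0P3cDyRamUniformizerPowerTube.v_pow_eq_exp_neg hϖE]) j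
    have hJ' : 2 * n ≤ J := by
      by_contra hlt
      exact hJ ((hiff (J + 1)).2 (by omega))
    -- INSTANCES ON `L_w` and the hermitian letters of the two plane forms
    haveI : IsDiscreteValuationRing 𝒪[w.1.adicCompletion L] := inferInstanceAs (IsDiscreteValuationRing (w.1.adicCompletionIntegers L))
    haveI : Finite 𝓀[w.1.adicCompletion L] := Finite.of_fintype (Valued.ResidueField (w.1.adicCompletion L))
    have hH₂ : IsUnit (placeForm (Matrix.of fun i j : Fin 2 => if i.val + j.val + 1 = 2 then (1 : L) else 0) w.1).det := isUnit_det_placeForm L v w _ (isUnit_antidiagOne_det L 2).ne_zero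
    have hH₂σ : ((placeForm (Matrix.of fun i j : Fin 2 => if i.val + j.val + 1 = 2 then (1 : L) else 0) w.1).map (galAdicCompletionMap (L := L) (IsCMField.complexConj L) hw))ᵀ = (placeForm (Matrix.of fun i j : Fin 2 => if i.val + j.val + 1 = 2 then (1 : L) else 0) w.1) := placeForm_map_transpose_of_hermitian L v w hw _ (antidiagOne_isHermitian L 2)
    have hH₂' : IsUnit (Matrix.diagonal dg).det := by
      rw [Matrix.det_diagonal]
      refine isUnit_iff_ne_zero.2 (Finset.prod_ne_zero_iff.2 fun i _ h0 => ?_)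
      have h1 := hdg1 i
      rw [h0, map_zero] at h1
      exact zero_ne_one h1
    have hDgσ : ((Matrix.diagonal dg).map (galAdicCompletionMap (L := L) (IsCMField.complexConj L) hw))ᵀ = Matrix.diagonal dg := by
      rw [Matrix.diagonal_map (map_zero _), Matrix.diagonal_transpose]
      exact congrArg Matrix.diagonal (funext hdgσ)
    -- THE FLIP UNIT (★ (β) ED. 2, from the hFN conjunct)
    have hFN := F0P3cDyRamTypeUBottomFacts.forall_fixed_fixed_isNorm_of_typeU hvρ hΘΘ hvΘ hα1 hA hτα hϖE
    obtain ⟨zf, ξ, hz1, hzξ, hσξ, hξN⟩ := F0P3cDyRamConeWeightHalfSplit.exists_flipUnit_of_forall_fixed_fixed_isNorm (galAdicCompletionMap (L := L) (IsCMField.complexConj L) hw) hD (toPlace w.1 w₁) hvΘ hΘj hjfix hjpow hFN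
    -- UNITARITY OF THE TWO BLOCK LITERALS for the block forms (from `hth`, `hta`, `hfc`)
    have hblock : placeForm (Matrix.of fun i j : Fin 3 => if i.val + j.val + 1 = 3 then (1 : L) else 0) w.1 = (!![(placeForm (Matrix.of fun i j : Fin 2 => if i.val + j.val + 1 = 2 then (1 : L) else 0) w.1) 0 0, 0, (placeForm (Matrix.of fun i j : Fin 2 => if i.val + j.val + 1 = 2 then (1 : L) else 0) w.1) 0 1; 0, (1 : w.1.adicCompletion L), 0; (placeForm (Matrix.of fun i j : Fin 2 => if i.val + j.val + 1 = 2 then (1 : L) else 0) w.1) 1 0, 0, (placeForm (Matrix.of fun i j : Fin 2 => if i.val + j.val + 1 = 2 then (1 : L) else 0) w.1) 1 1] : Matrix (Fin 3) (Fin 3) (w.1.adicCompletion L)) := by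
      rw [placeForm_antidiagOne, placeForm_antidiagOne, F0P3cDyRamFixedPointCensusTypeTwoPrelude.antidiagonal_three_over_eq_block_antidiagonal_two]
    have hΓ : endoGL ((((localNonsplitEquiv (IsCMField.complexConj L) (Matrix.of fun i j : Fin 2 => if i.val + j.val + 1 = 2 then (1 : L) else 0) (IsCMField.complexConj_ne_one L) w hw γH.1) : ↥(unitaryGroupOfForm (galAdicCompletionMap (L := L) (IsCMField.complexConj L) hw) (placeForm (Matrix.of fun i j : Fin 2 => if i.val + j.val + 1 = 2 then (1 : L) else 0) w.1))) : GL (Fin 2) (w.1.adicCompletion L)), (((localNonsplitEquiv (IsCMField.complexConj L) (Matrix.of fun i j : Fin 1 => if i.val + j.val + 1 = 1 then (1 : L) else 0) (IsCMField.complexConj_ne_one L) w hw γH.2)).val : GL (Fin 1) (w.1.adicCompletion L))) ∈ unitaryGroupOfForm (galAdicCompletionMap (L := L) (IsCMField.complexConj L) hw) (!![(placeForm (Matrix.of fun i j : Fin 2 => if i.val + j.val + 1 = 2 then (1 : L) else 0) w.1) 0 0, 0, (placeForm (Matrix.of fun i j : Fin 2 => if i.val + j.val + 1 = 2 then (1 :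 L) else 0) w.1) 0 1; 0, (1 : w.1.adicCompletion L), 0; (placeForm (Matrix.of fun i j : Fin 2 => if i.val + j.val + 1 = 2 then (1 : L) else 0) w.1) 1 0, 0, (placeForm (Matrix.of fun i j : Fin 2 => if i.val + j.val + 1 = 2 then (1 : L) else 0) w.1) 1 1] : Matrix (Fin 3) (Fin 3) (w.1.adicCompletion L)) := by
      rw [← hblock, ← hth]
      exact (localNonsplitEquiv (IsCMField.complexConj L) (Matrix.of fun i j : Fin 3 => if i.val + j.val + 1 = 3 then (1 : L) else 0) (IsCMField.complexConj_ne_one L) w hw th).2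
    have hmem' : P₁ * endoGL (γ₁, (((localNonsplitEquiv (IsCMField.complexConj L) (Matrix.of fun i j : Fin 1 => if i.val + j.val + 1 = 1 then (1 : L) else 0) (IsCMField.complexConj_ne_one L) w hw γH.2)).val : GL (Fin 1) (w.1.adicCompletion L))) * P₁⁻¹ ∈ unitaryGroupOfForm (galAdicCompletionMap (L := L) (IsCMField.complexConj L) hw) (placeForm (Matrix.of fun i j : Fin 3 => if i.val + j.val + 1 = 3 then (1 : L) else 0) w.1) := by
      rw [← hta]
      exact (localNonsplitEquiv (IsCMField.complexConj L) (Matrix.of fun i j : Fin 3 => if i.val + j.val + 1 = 3 then (1 : L) else 0) (IsCMField.complexConj_ne_one L) w hw ta).2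
    have hΓ' : endoGL (γ₁, (((localNonsplitEquiv (IsCMField.complexConj L) (Matrix.of fun i j : Fin 1 => if i.val + j.val + 1 = 1 then (1 : L) else 0) (IsCMField.complexConj_ne_one L) w hw γH.2)).val : GL (Fin 1) (w.1.adicCompletion L))) ∈ unitaryGroupOfForm (galAdicCompletionMap (L := L) (IsCMField.complexConj L) hw) (!![(Matrix.diagonal dg) 0 0, 0, (Matrix.diagonal dg) 0 1; 0, η, 0; (Matrix.diagonal dg) 1 0, 0, (Matrix.diagonal dg) 1 1] : Matrix (Fin 3) (Fin 3) (w.1.adicCompletion L)) := by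
      rw [← hfc]
      exact (conj_mem_unitaryGroupOfForm_iff (galAdicCompletionMap (L := L) (IsCMField.complexConj L) hw) P₁ _ (endoGL (γ₁, (((localNonsplitEquiv (IsCMField.complexConj L) (Matrix.of fun i j : Fin 1 => if i.val + j.val + 1 = 1 then (1 : L) else 0) (IsCMField.complexConj_ne_one L) w hw γH.2)).val : GL (Fin 1) (w.1.adicCompletion L))))).1 hmem'
    -- the socket's `hR` in the block-form currency (frame h; `IsSelfDualLattice` is `IsVertexLattice … 0`); `hR'` is already so
    have hR₁ := fun M₃ (hM₃ : IsSelfDualLattice (galAdicCompletionMap (L := L) (IsCMField.complexConj L) hw) ϖ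
        (!![(placeForm (Matrix.of fun i j : Fin 2 => if i.val + j.val + 1 = 2 then (1 : L) else 0) w.1) 0 0, 0, (placeForm (Matrix.of fun i j : Fin 2 => if i.val + j.val + 1 = 2 then (1 : L) else 0) w.1) 0 1; 0, (1 : w.1.adicCompletion L), 0; (placeForm (Matrix.of fun i j : Fin 2 => if i.val + j.val + 1 = 2 then (1 : L) else 0) w.1) 1 0, 0, (placeForm (Matrix.of fun i j : Fin 2 => if i.val + j.val + 1 = 2 then (1 : L) else 0) w.1) 1 1] : Matrix (Fin 3) (Fin 3) (w.1.adicCompletion L)) M₃) =>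
      hR M₃ (by have h := hM₃; rw [← hblock, placeForm_antidiagOne] at h; exact h)
    -- GAP-R (★ LH4-p05): non-empty depth cells have `b ≤ R` / `b ≤ R'`
    have hRcells : ∀ j b, 1 ≤ b → IsOrd (galAdicCompletionMap (L := E') c₁ hw₁) α (toPlace w.1 w₁ ϖ ^ j) lam →
        (levelSetDep (galAdicCompletionMap (L := E') c₁ hw₁) Θ α (toPlace w.1 w₁ ϖ) h j b (lam - toPlace w.1 w₁ (((((localNonsplitEquiv (IsCMField.complexConj L) (Matrix.of fun i j : Fin 1 => if i.val + j.val + 1 = 1 then (1 : L) else 0) (IsCMField.complexConj_ne_one L) w hw γH.2)).val : GL (Fin 1) (w.1.adicCompletion L)) : Matrix (Fin 1) (Fin 1) (w.1.adicCompletion L)) 0 0))).Nonempty → b ≤ R :=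
      fun j b hb hlamj hne => F0P3cDyRamConeTubeBound.le_of_levelSetDep_nonempty (galAdicCompletionMap (L := L) (IsCMField.complexConj L) hw) hσσ hσv hϖ hD h2v hH₂ hH₂σ (hW := (1 : w.1.adicCompletion L)) (by rw [map_one]) (map_one _)
        (toPlace w.1 w₁) hρρ hvρ hα hα1 hint hΘΘ hΘρ hvΘ hΘj hjv hjfix hjpow hϖmax φ hφs hφi hφo hφγ hlam hΘh hh hform zf hz1 ξ hzξ hσξ hξN (((localNonsplitEquiv (IsCMField.complexConj L) (Matrix.of fun i j : Fin 1 => if i.val + j.val + 1 = 1 then (1 : L) else 0) (IsCMField.complexConj_ne_one L) w hw γH.2)).val : GL (Fin 1) (w.1.adicCompletion L)) hΓ hu hR₁ hb hlamj hne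
    have hRcells' : ∀ j b, 1 ≤ b → IsOrd (galAdicCompletionMap (L := E') c₁ hw₁) α (toPlace w.1 w₁ ϖ ^ j) lam →
        (levelSetDep (galAdicCompletionMap (L := E') c₁ hw₁) Θ α (toPlace w.1 w₁ ϖ) h' j b (lam - toPlace w.1 w₁ (((((localNonsplitEquiv (IsCMField.complexConj L) (Matrix.of fun i j : Fin 1 => if i.val + j.val + 1 = 1 then (1 : L) else 0) (IsCMField.complexConj_ne_one L) w hw γH.2)).val : GL (Fin 1) (w.1.adicCompletion L)) : Matrix (Fin 1) (Fin 1) (w.1.adicCompletion L)) 0 0))).Nonempty → b ≤ R' :=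
      fun j b hb hlamj hne => F0P3cDyRamConeTubeBound.le_of_levelSetDep_nonempty (galAdicCompletionMap (L := L) (IsCMField.complexConj L) hw) hσσ hσv hϖ hD h2v hH₂' hDgσ hη1 hησ
        (toPlace w.1 w₁) hρρ hvρ hα hα1 hint hΘΘ hΘρ hvΘ hΘj hjv hjfix hjpow hϖmax φ' hφ's hφ'i hφ'o hφ'γ hlam hΘh' hh' hform' zf hz1 ξ hzξ hσξ hξN (((localNonsplitEquiv (IsCMField.complexConj L) (Matrix.of fun i j : Fin 1 => if i.val + j.val + 1 = 1 then (1 : L) else 0) (IsCMField.complexConj_ne_one L) w hw γH.2)).val : GL (Fin 1) (w.1.adicCompletion L)) hΓ' hu hR' hb hlamj hne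
    -- REINDEX ×2 (★ LH4-p08)
    have hre := F0P3cDyRamToricLevelCensusUnr.orderCounts_eq_censusSum_unr_of_cells hρρ hvρ hΘΘ hΘρ hvΘ hα1 hA (hρj ϖ) hϖE hh hmE hjl
      (Nat.card 𝓀[(w.1.adicCompletion L)]) hiff hJ' hRcells
    have hre' := F0P3cDyRamToricLevelCensusUnr.orderCounts_eq_censusSum_unr_of_cells hρρ hvρ hΘΘ hΘρ hvΘ hα1 hA (hρj ϖ) hϖE hh' hmE hjl
      (Nat.card 𝓀[(w.1.adicCompletion L)]) hiff hJ' hRcells'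
    rw [show ((((localNonsplitEquiv (IsCMField.complexConj L) (Matrix.of fun i j : Fin 1 => if i.val + j.val + 1 = 1 then (1 : L) else 0) (IsCMField.complexConj_ne_one L) w hw γH.2).val : GL (Fin 1) (w.1.adicCompletion L)) : Matrix (Fin 1) (Fin 1) (w.1.adicCompletion L)) 0 0) = finGammaTwo L v γH w from rfl, hre, hre']
    -- LETTERS OF THE WELD (★ brick 1 transport, ★ p10 residue count, ★ brick 2 anisotropy, depth bounds ★5∕★7, ★ p858055)
    haveI : IsDiscreteValuationRing 𝒪[w₁.1.adicCompletion E'] := inferInstanceAs (IsDiscreteValuationRing (w₁.1.adicCompletionIntegers E'))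
    obtain ⟨hddE, hfixE, h2E⟩ := F0P3cDyRamTypeUBottomFacts.transported_datum (ρ := galAdicCompletionMap (L := E') c₁ hw₁) (galAdicCompletionMap (L := L) (IsCMField.complexConj L) hw) hD (toPlace w.1 w₁) hΘj hjfix hjpow hϖE
    have hqM := F0P3cDyRamUnramifiedQuadraticCompletionDictionary.natCard_residueField_eq_sq_of_v_sub_galAdicCompletionMap_eq_one E' c₁ w.1 hc₁ w₁ hw₁ hα1 hA
    have hdg0 : ∀ i, dg i ≠ 0 := fun i h0 => by have h1 := hdg1 i; rw [h0, map_zero] at h1; exact zero_ne_one h1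
    have hfc' : formCongr (galAdicCompletionMap (L := L) (IsCMField.complexConj L) hw) P₁ ((StdForm.antidiagonal 3).over (w.1.adicCompletion L)) =
        (!![(Matrix.diagonal dg) 0 0, 0, (Matrix.diagonal dg) 0 1; 0, η, 0; (Matrix.diagonal dg) 1 0, 0, (Matrix.diagonal dg) 1 1] : Matrix (Fin 3) (Fin 3) (w.1.adicCompletion L)) := by
      rw [← placeForm_antidiagOne]; exact hfc
    have haniso := F0P3cDyRamTypeTwoAnisotropyOfFrame.not_exists_herm_self_eq_zero_of_lineModel (ρ := galAdicCompletionMap (L := E') c₁ hw₁) (Θ := Θ) (galAdicCompletionMap (L := L) (IsCMField.complexConj L) hw) (Matrix.diagonal dg)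
      (toPlace w.1 w₁) φ' hφ'o hform' (F0P3cDyRamTypeTwoAnisotropyOfFrame.not_exists_pairing_diagonal_self_eq_zero_of_formCongr (galAdicCompletionMap (L := L) (IsCMField.complexConj L) hw) P₁ dg η hfc' hdgσ hdg0 hηN)
    have hlam' : lam * Θ lam = 1 := by rw [mul_comm]; exact hΘlam
    have hq2 : 2 ≤ Nat.card 𝓀[(w.1.adicCompletion L)] := Finite.one_lt_card
    have hd2 := (F0P3cDyRamSideNormCriterionRamK.two_le_of_datum_of_v_two_lt_one hD h2v).1
    have hNm : 2 * d + 4 * tE + 2 + tE ≤ 2 * m :=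
      F0P3cDyRamTypeTwoTubeLetters.le_two_mul_depth_of_congr (F0P3cDyRamUniformizerPowerTube.v_pow_le_one hϖ _) hg hu₂ htok
        (F0P3cDyRamUniformizerPowerTube.v_pow_le_exp_neg hϖ _)
    have hdm : d ≤ m := by omega
    have hmS : d - d % 2 ≤ m + 1 := by omega
    have hjl2 : (2 * n) % 2 = 0 := by omega
    -- THE SIGN `ε = (β, θ)_v = (−1)^(m+d)` (★ O-Sign; step 15) and REALIZABILITY (★ LH4-p14 `hreal_of_frame_typeU`)
    have hε : ((hilbertSymbol (v.adicCompletion ↥(maximalRealSubfield L)) (β : (v.adicCompletion ↥(maximalRealSubfield L)))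
        (algebraMap ↥(maximalRealSubfield L) _ ((cmQuadraticGenerator L : 𝓞 ↥(maximalRealSubfield L)) : ↥(maximalRealSubfield L))) : ℤ) : ℚ) = (-1) ^ (m + d) := by
      rw [F0P3cDyRamOrderCountCensusUnrSign.sign_typeA L w hw he ϖ hϖ d tE hD h2v γH hg hu₂ E' c₁ w₁ hw₁ Θ α lam hc₁ hDD htr hρρ hvρ hρj hjv hjfix hΘj hΘΘ
        hΘρ hvΘ hα1 hint hlam2 hρlam hΘlam hA hτα hu hjlv hm hβ]
      push_cast; ring
    have hreal := F0P3cDyRamTokenRealizabilityUnrOfFrame.hreal_of_frame_typeU hD h2v hρρ hvρ hΘΘ hΘρ hvΘ (toPlace w.1 w₁) hjfix hΘj hjv1 hα1 hA hτα hd2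
      hlam' hρu hu1 hmE hjl hdm hjl2 _ hε
    -- THE G-SIDE WELD (★ T5b × T5s at the third field)
    have hweld := F0P3cDyRamToricLevelCensusUnrAtThirdField.toricCensusSum_unr_weld_of_frame hρρ hvρ hΘΘ hΘρ hvΘ hα1 hA (hρj ϖ) hϖE hqM hτα hd1 hddE hfixE h2E
      hΘh hh hiso hΘh' hh' haniso hlam' hρu hu1 hmE hjl hq2 hd2 hjl2 hmS _ hreal
    -- THE BOTTOM ARITHMETIC (★ LH4-p07)
    have hεpm : (hilbertSymbol (v.adicCompletion ↥(maximalRealSubfield L)) (β : (v.adicCompletion ↥(maximalRealSubfield L)))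
        (algebraMap ↥(maximalRealSubfield L) _ ((cmQuadraticGenerator L : 𝓞 ↥(maximalRealSubfield L)) : ↥(maximalRealSubfield L))) : ℤ) = 1 ∨
        (hilbertSymbol (v.adicCompletion ↥(maximalRealSubfield L)) (β : (v.adicCompletion ↥(maximalRealSubfield L)))
        (algebraMap ↥(maximalRealSubfield L) _ ((cmQuadraticGenerator L : 𝓞 ↥(maximalRealSubfield L)) : ↥(maximalRealSubfield L))) : ℤ) = -1 :=
      hilbertSymbol_eq_one_or_eq_neg_one _ _
    have hqc : Nat.card 𝓀[(w.1.adicCompletion L)] = Fintype.card (Valued.ResidueField (w.1.adicCompletion L)) := Nat.card_eq_fintype_card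
    have hn2 : 2 * n / 2 = n := by omega
    rw [hqc, hn2] at hweld
    rw [hqc]
    have hweld' : ((hilbertSymbol (v.adicCompletion ↥(maximalRealSubfield L)) (β : (v.adicCompletion ↥(maximalRealSubfield L)))
        (algebraMap ↥(maximalRealSubfield L) _ ((cmQuadraticGenerator L : 𝓞 ↥(maximalRealSubfield L)) : ↥(maximalRealSubfield L))) : ℤ) : ℚ) *
        (((∑ j ∈ Finset.range (2 * n + 1), ∑ a ∈ Finset.range (2 * n + 2), Fintype.card (Valued.ResidueField (w.1.adicCompletion L)) ^ a *
            (levelSetDep (galAdicCompletionMap (L := E') c₁ hw₁) Θ α (toPlace w.1 w₁ ϖ) h j a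
              (lam - toPlace w.1 w₁ ((((localNonsplitEquiv (IsCMField.complexConj L) (Matrix.of fun i j : Fin 1 => if i.val + j.val + 1 = 1 then (1 : L) else 0)
                (IsCMField.complexConj_ne_one L) w hw γH.2).val : GL (Fin 1) (w.1.adicCompletion L)) : Matrix (Fin 1) (Fin 1) (w.1.adicCompletion L)) 0 0))).ncard : ℕ) : ℚ) -
          ((∑ j ∈ Finset.range (2 * n + 1), ∑ a ∈ Finset.range (2 * n + 2), Fintype.card (Valued.ResidueField (w.1.adicCompletion L)) ^ a *
            (levelSetDep (galAdicCompletionMap (L := E') c₁ hw₁) Θ α (toPlace w.1 w₁ ϖ) h' j a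
              (lam - toPlace w.1 w₁ ((((localNonsplitEquiv (IsCMField.complexConj L) (Matrix.of fun i j : Fin 1 => if i.val + j.val + 1 = 1 then (1 : L) else 0)
                (IsCMField.complexConj_ne_one L) w hw γH.2).val : GL (Fin 1) (w.1.adicCompletion L)) : Matrix (Fin 1) (Fin 1) (w.1.adicCompletion L)) 0 0))).ncard : ℕ) : ℚ)) =
        (Fintype.card (Valued.ResidueField (w.1.adicCompletion L)) : ℚ) ^ m *
          ((1 + ((Fintype.card (Valued.ResidueField (w.1.adicCompletion L)) : ℚ) + 1) * ∑ i ∈ Finset.range n, (Fintype.card (Valued.ResidueField (w.1.adicCompletion L)) : ℚ) ^ i) -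
            2 * ∑ i ∈ Finset.range (d - d % 2), (Fintype.card (Valued.ResidueField (w.1.adicCompletion L)) : ℚ) ^ i) := by
      rw [← hweld]
      congr 1
      push_cast
      rw [← Finset.sum_sub_distrib]
      refine Finset.sum_congr rfl fun j _ => ?_
      rw [← Finset.sum_sub_distrib]
      refine Finset.sum_congr rfl fun a _ => ?_
      ring
    exact F0P3cDyRamCensusBottomArith.census_bottom_arith_inert hεpm hweld' hFix (by omega)


end Summit.HodgeConjecture.HodgeConjecture.Cruxes.H413.F0P3cDyRamOrderCountCensusUnr

end
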